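import Summits.Ventures.YMGap.Census.PotentialMoving
import Summits.Ventures.YMGap.Census.CharacterPowerExpansion
import Summits.Ventures.YMGap.Census.TwoDimDecimation
import Literature.MathematicalPhysics.QuantumFieldTheory.MullerSchiemann1987.MS87HeatKernelGroup
import HarnessLib

/-!
# Venture YMGap, track (b) — the ONE-LINK CONFIGURATION and the non-constancy of the plaquette function
# (the tools deciding STRICTNESS of Tomboulis's potential-moving step, arXiv:0707.2179 App. A §4)

HONEST FRAMING: venture file of the cell `pub-ymgap` (QuantumFields programme), track (b) census; finite tori `(ℤ/Lℤ)^d`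
only; elementary facts about ONE gauge configuration and one-plaquette Haar integrals; nothing about (5.15), limits,
confinement or a mass gap.

Tomboulis's potential-moving upper bound (Prop. III.1, App. A §4 (A.14)–(A.19); tree: `PotentialMoving`, `Decimation`) is
an EQUALITY in `d = 2` (`TwoDimDecimation`) and — as used silently in §3.2 («there exist a value of `α` in `(0,1)`»,
(3.23)) — STRICT in `d ≥ 3` unless all `c_j` vanish.  Strictness is decided at ONE configuration, the one-link
configuration `U_{e₀} = g`, `U_e = 1 (e ≠ e₀)`.  This file provides:
* `powFieldZ_mkExpS_le_union`, `powFieldZ_mkExpS_le_univ` — the moved partition functions `Z(mkExpS S)` of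
  `PotentialMoving` are non-decreasing in the set `S` of processed directions;
* `plaqFn_one_right` (`f_c(1) = 1 + Σ (n+1)² c_n`), `one_lt_plaqFn_one`, `integral_plaqFn` (`∫ f_c dHaar = 1`),
  `exists_plaqFn_ne_one`, **`exists_plaqFn_pos_ne_one`**: if some `c_n > 0` (all `c_n ≥ 0`) there is `g₁ ∈ SU(2)` with
  `0 < f_c(g₁) ≠ f_c(1)` (mean value `1 < f_c(1)`; intermediate values along the diagonal subgroup `diagPhase` of
  `MS87HeatKernelGroup`, `Re tr diag(e^{-ix}, e^{ix}) = 2 cos x`);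
* `oneLink` and its plaquette holonomies: `hol_oneLink_cases` (each is `1`, `g` or `g⁻¹` on a torus of side `≥ 2`),
  `hol_oneLink_eq_one_of_ne` (plaquettes `⊥ κ` off the link's `κ`-slice are trivial), `hol_oneLink_base` (the plaquette
  whose first edge is the link carries `g`), `fR_oneLink_pos`;
* `sliceSet` — the `κ`-slices `S_i = {p ⊥ κ : x_κ(p) ≡ i (mod b)}` underlying `PotentialMoving.sliceFn` — with
  `card_sliceSet_succ` (all slices are equinumerous, by the unit translation along `κ`), and the two evaluations
  **`sliceFn_oneLink_of_ne`** (`= f(1)^{#S_i}` for `i ≠ 0`) and **`sliceFn_oneLink_zero_ne`** (`≠ f(1)^{#S_0}`) at the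
  one-link configuration based at `x₀ = 0` with `0 < f(g) ≠ f(1)` (`b ≥ 2`; the marked plaquette needs two directions
  `μ, ν ≠ κ`, i.e. `d ≥ 3`).

References: E. T. Tomboulis, arXiv:0707.2179, §3.2 (3.23) and App. A §4 [cite: Tomboulis2007Confinement, App. A §4];
A. A. Migdal, Sov. Phys. JETP 42 (1975) 413; L. P. Kadanoff, Ann. Phys. 100 (1976) 359 (potential moving) [folklore].
-/

noncomputable section

open MeasureTheory Finset Real Function
open scoped BigOperators
open Literature.MathematicalPhysics.QuantumLattice
open Literature.MathematicalPhysics.QuantumFieldTheory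
open Literature.MathematicalPhysics.QuantumFieldTheory.Tomboulis2007
open Literature.MathematicalPhysics.QuantumFieldTheory.WilsonRP
open Summit.Ventures.LatticeQCDFlow.Exactness
open Summit.Ventures.LatticeQCDFlow.Scoring

namespace Summit.Ventures.YMGap.Census

variable {d L : ℕ}

/-! ### Monotonicity of the moved partition functions in the set of processed directions -/

section MonoS

variable (b : ℕ) [NeZero b] [NeZero L]

/-- **More moves, larger `Z`**: `Z(mkExpS S) ≤ Z(mkExpS (S ∪ T))` on the positivity domain. -/
theorem powFieldZ_mkExpS_le_union (J : ℕ) {c : ℕ → ℝ} (hf : ∀ g : SU2, 0 ≤ plaqFn J c g) (S T : Finset (Fin d)) :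
    powFieldZ J c (mkExpS (L := L) b S) ≤ powFieldZ J c (mkExpS (L := L) b (S ∪ T)) := by
  induction T using Finset.induction_on with
  | empty => rw [Finset.union_empty]
  | insert κ T hκ ih =>
    by_cases hκS : κ ∈ S
    · rwa [Finset.union_insert, Finset.insert_eq_of_mem (Finset.mem_union_left T hκS)]
    · have hκ' : κ ∉ S ∪ T := by simp [hκS, hκ]
      calc powFieldZ J c (mkExpS b S) ≤ powFieldZ J c (mkExpS b (S ∪ T)) := ih
        _ ≤ powFieldZ J c (moveExp b κ (mkExpS b (S ∪ T))) :=
            powFieldZ_le_powFieldZ_moveExp b J hf κ (mkExpS_plaqShift_single b hκ')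
        _ = powFieldZ J c (mkExpS b (S ∪ insert κ T)) := by rw [moveExp_mkExpS b hκ', Finset.union_insert]

/-- `Z(mkExpS S) ≤ Z(mkExpS univ) = Z(e_MK)`. -/
theorem powFieldZ_mkExpS_le_univ (J : ℕ) {c : ℕ → ℝ} (hf : ∀ g : SU2, 0 ≤ plaqFn J c g) (S : Finset (Fin d)) :
    powFieldZ J c (mkExpS (L := L) b S) ≤ powFieldZ J c (mkExpS (L := L) b (univ : Finset (Fin d))) := by
  have h := powFieldZ_mkExpS_le_union (L := L) b J hf S univ
  rwa [Finset.union_eq_right.2 (Finset.subset_univ S)] at h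

end MonoS

/-! ### A plaquette function with a positive coefficient is not constant -/

section Nonconstant

/-- `χ_n(1) = n + 1` (`= d_j`). -/
theorem su2Char_one_right (n : ℕ) : su2Char n (1 : SU2) = (n : ℝ) + 1 := by
  simp [su2Char, Matrix.trace_one, Polynomial.Chebyshev.U_eval_one]

/-- `f_c(1) = 1 + Σ_{n=1}^{J} (n+1)² c_n`. -/
theorem plaqFn_one_right (J : ℕ) (c : ℕ → ℝ) :
    plaqFn J c (1 : SU2) = 1 + ∑ n ∈ Icc 1 J, ((n : ℝ) + 1) ^ 2 * c n := by
  unfold plaqFn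
  simp_rw [su2Char_one_right]
  congr 1
  refine Finset.sum_congr rfl fun n _ => ?_
  ring

/-- `f_c(1) > 1` as soon as one coefficient in range is positive (and all are `≥ 0`). -/
theorem one_lt_plaqFn_one {J : ℕ} {c : ℕ → ℝ} (hc : ∀ n, 1 ≤ n → 0 ≤ c n) {n₀ : ℕ} (hn₀ : n₀ ∈ Icc 1 J)
    (hpos : 0 < c n₀) : 1 < plaqFn J c (1 : SU2) := by
  rw [plaqFn_one_right]
  have hle : ((n₀ : ℝ) + 1) ^ 2 * c n₀ ≤ ∑ n ∈ Icc 1 J, ((n : ℝ) + 1) ^ 2 * c n :=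
    Finset.single_le_sum (f := fun n : ℕ => ((n : ℝ) + 1) ^ 2 * c n)
      (fun n hn => mul_nonneg (by positivity) (hc n (Finset.mem_Icc.1 hn).1)) hn₀
  have hpos' : 0 < ((n₀ : ℝ) + 1) ^ 2 * c n₀ := by positivity
  linarith

/-- `∫ f_c dHaar = 1` (the constant Fourier mode; `F̂_0 = 1` at `ζ = 1`). -/
theorem integral_plaqFn (J : ℕ) (c : ℕ → ℝ) : ∫ g, plaqFn J c g ∂(haarProbability SU2) = 1 := by
  have h := mkFhat_one_zero J c
  unfold mkFhat at h
  rw [← h]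
  refine integral_congr_ae (ae_of_all _ fun g => ?_)
  simp [su2Char]

/-- **Non-constancy**: if some `c_n > 0` then `f_c(g₀) ≠ f_c(1)` for some `g₀ ∈ SU(2)`. -/
theorem exists_plaqFn_ne_one {J : ℕ} {c : ℕ → ℝ} (hc : ∀ n, 1 ≤ n → 0 ≤ c n) {n₀ : ℕ} (hn₀ : n₀ ∈ Icc 1 J)
    (hpos : 0 < c n₀) : ∃ g₀ : SU2, plaqFn J c g₀ ≠ plaqFn J c 1 := by
  by_contra h
  push Not at h
  have h1 : ∫ g, plaqFn J c g ∂(haarProbability SU2) = plaqFn J c 1 := by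
    rw [integral_congr_ae (ae_of_all _ h), integral_const, smul_eq_mul]
    simp
  have h2 := one_lt_plaqFn_one hc hn₀ hpos
  rw [← h1, integral_plaqFn] at h2
  exact lt_irrefl _ h2

/-- `Re tr g = 2 a₀(g)` (plumbing). -/
theorem trace_re_eq_two_mul_su2a0 (g : SU2) : ((rhoFund g).trace).re = 2 * su2a0 g := by
  unfold su2a0
  simp [rhoFund, fundamentalRep]
  ring

/-- `|a₀(g)| ≤ 1` on `SU(2)`. -/
theorem su2a0_mem_Icc (g : SU2) : su2a0 g ∈ Set.Icc (-1 : ℝ) 1 := by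
  have h := su2_sum_sq g
  constructor <;>
    nlinarith [sq_nonneg (su2x genZ1 g), sq_nonneg (su2x genZ2 g), sq_nonneg (su2x genZ3 g), sq_nonneg (su2a0 g)]

/-- `f_c(g) = fR(2 a₀(g))`. -/
theorem plaqFn_eq_fR_su2a0 (J : ℕ) (c : ℕ → ℝ) (g : SU2) : plaqFn J c g = fR J c (2 * su2a0 g) := by
  rw [plaqFn_eq_fR, trace_re_eq_two_mul_su2a0]

open MullerSchiemann1987.HeatKernel in
/-- The diagonal element `diag(e^{-ix}, e^{ix})` has `Re tr = 2 cos x`. -/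
theorem trace_re_diagPhase (x : ℝ) : ((rhoFund (diagPhase x)).trace).re = 2 * Real.cos x := by
  have h : (rhoFund (diagPhase x)) = ((diagPhase x : SU2) : Matrix (Fin 2) (Fin 2) ℂ) := rfl
  rw [h, coe_diagPhase, Matrix.trace_fin_two_of, Complex.add_re, Complex.exp_ofReal_mul_I_re,
    Complex.exp_ofReal_mul_I_re, Real.cos_neg]
  ring

open MullerSchiemann1987.HeatKernel in
/-- **A group element with `0 < f_c(g₁) ≠ f_c(1)`** whenever some `c_n > 0` on the positivity domain
(`f_c` continuous, `∫ f_c = 1 < f_c(1)`, intermediate values along the diagonal subgroup). -/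
theorem exists_plaqFn_pos_ne_one {J : ℕ} {c : ℕ → ℝ} (hc : ∀ n, 1 ≤ n → 0 ≤ c n)
    {n₀ : ℕ} (hn₀ : n₀ ∈ Icc 1 J) (hpos : 0 < c n₀) :
    ∃ g₁ : SU2, 0 < plaqFn J c g₁ ∧ plaqFn J c g₁ ≠ plaqFn J c 1 := by
  obtain ⟨g₀, hg₀⟩ := exists_plaqFn_ne_one hc hn₀ hpos
  -- the plaquette function along `y = a₀`
  set P : ℝ → ℝ := fun y => fR J c (2 * y) with hP
  have hPc : Continuous P := (continuous_fR J c).comp (continuous_const.mul continuous_id)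
  have hP1 : P 1 = plaqFn J c 1 := by
    rw [plaqFn_eq_fR_su2a0]
    simp [hP, su2a0]
  have hPg₀ : P (su2a0 g₀) = plaqFn J c g₀ := by rw [plaqFn_eq_fR_su2a0]
  have hy₀ := su2a0_mem_Icc g₀
  have hf1 : 0 < plaqFn J c 1 := zero_lt_one.trans (one_lt_plaqFn_one hc hn₀ hpos)
  -- a point `y₁ ∈ [-1, 1]` with `0 < P y₁ ≠ P 1`
  obtain ⟨y₁, hy₁, hPy₁, hPy₁'⟩ : ∃ y₁ ∈ Set.Icc (-1 : ℝ) 1, 0 < P y₁ ∧ P y₁ ≠ P 1 := by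
    by_cases hpos₀ : 0 < plaqFn J c g₀
    · exact ⟨su2a0 g₀, hy₀, by rwa [hPg₀], by rwa [hPg₀, hP1]⟩
    · have hle : P (su2a0 g₀) ≤ P 1 / 2 := by rw [hPg₀, hP1]; linarith [not_lt.1 hpos₀]
      have hge : P 1 / 2 ≤ P 1 := by rw [hP1]; linarith
      obtain ⟨y₁, hy₁, hy₁eq⟩ := intermediate_value_Icc hy₀.2 (hPc.continuousOn) ⟨hle, hge⟩
      refine ⟨y₁, ⟨hy₀.1.trans hy₁.1, hy₁.2⟩, ?_, ?_⟩
      · rw [hy₁eq, hP1]; linarith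
      · rw [hy₁eq, hP1]; linarith
  refine ⟨diagPhase (Real.arccos y₁), ?_, ?_⟩ <;>
    rw [plaqFn_eq_fR, trace_re_diagPhase, Real.cos_arccos hy₁.1 hy₁.2]
  · exact hPy₁
  · rwa [← hP1]

end Nonconstant

/-! ### The one-link configuration -/

section OneLink

/-- **The one-link configuration**: the link `e₀` carries `g`, every other link carries `1`. -/
def oneLink (e₀ : Edge d L) (g : SU2) : GaugeConfig d L SU2 := Function.update 1 e₀ g

/-- The value of a link in the one-link configuration. -/
theorem oneLink_apply (e₀ : Edge d L) (g : SU2) (e : Edge d L) : oneLink e₀ g e = if e = e₀ then g else 1 := by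
  unfold oneLink
  rw [Function.update_apply, Pi.one_apply]

/-- **Every plaquette holonomy of the one-link configuration is `1`, `g` or `g⁻¹`** (a plaquette of a torus of
side `≥ 2` passes through a given link at most once). -/
theorem hol_oneLink_cases [Fact (1 < L)] (e₀ : Edge d L) (g : SU2) (p : Plaquette d L) :
    plaquetteHolonomy (oneLink e₀ g) p.1 p.2.1.1 p.2.1.2 = 1 ∨
      plaquetteHolonomy (oneLink e₀ g) p.1 p.2.1.1 p.2.1.2 = g ∨
      plaquetteHolonomy (oneLink e₀ g) p.1 p.2.1.1 p.2.1.2 = g⁻¹ := by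
  obtain ⟨x, ⟨⟨a, a'⟩, haa'⟩⟩ := p
  have hne : a ≠ a' := ne_of_lt haa'
  simp only [plaquetteHolonomy, oneLink_apply]
  by_cases h1 : (x, a) = e₀
  · subst h1
    have h2 : (x.shift a, a') ≠ (x, a) := fun h => hne.symm (congrArg Prod.snd h)
    have h3 : (x.shift a', a) ≠ (x, a) := fun h => shift_ne_self' x a' (congrArg Prod.fst h)
    have h4 : (x, a') ≠ (x, a) := fun h => hne.symm (congrArg Prod.snd h)
    simp [h2, h3, h4]
  · by_cases h2 : (x.shift a, a') = e₀
    · subst h2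
      have h3 : (x.shift a', a) ≠ (x.shift a, a') := fun h => hne (congrArg Prod.snd h)
      have h4 : (x, a') ≠ (x.shift a, a') := fun h => self_ne_shift' x a (congrArg Prod.fst h)
      simp [h1, h3, h4]
    · by_cases h3 : (x.shift a', a) = e₀
      · subst h3
        have h4 : (x, a') ≠ (x.shift a', a) := fun h => hne.symm (congrArg Prod.snd h)
        simp [h1, h2, h4]
      · by_cases h4 : (x, a') = e₀
        · subst h4
          simp [h1, h2, h3]
        · simp [h1, h2, h3, h4]

/-- **The plaquette function of the one-link configuration takes only the values `f(1)` and `f(g)`.** -/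
theorem plaqFn_hol_oneLink_cases [Fact (1 < L)] (J : ℕ) (c : ℕ → ℝ) (e₀ : Edge d L) (g : SU2) (p : Plaquette d L) :
    fR J c (plaqRe rhoFund (oneLink e₀ g) p) = plaqFn J c 1 ∨ fR J c (plaqRe rhoFund (oneLink e₀ g) p) = plaqFn J c g := by
  rw [← plaqFn_hol_eq_fR]
  rcases hol_oneLink_cases e₀ g p with h | h | h
  · exact Or.inl (by rw [h])
  · exact Or.inr (by rw [h])
  · exact Or.inr (by rw [h, plaqFn_inv'])

/-- Shifting a site along `a ≠ κ` does not change its `κ`-coordinate. -/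
theorem shift_apply_of_ne (x : Site d L) {a κ : Fin d} (h : κ ≠ a) : (x.shift a) κ = x κ := by
  simp [Site.shift, Pi.single_eq_of_ne h]

/-- **Plaquettes `⊥ κ` off the `κ`-slice of the link are trivial**: if `κ` is perpendicular to `p` and the
`κ`-coordinate of `p` differs from that of `e₀`, then the holonomy of `p` in the one-link configuration is `1`. -/
theorem hol_oneLink_eq_one_of_ne (e₀ : Edge d L) (g : SU2) {κ : Fin d} {p : Plaquette d L} (hκ : κ ∈ perpDirs p)
    (hx : p.1 κ ≠ e₀.1 κ) : plaquetteHolonomy (oneLink e₀ g) p.1 p.2.1.1 p.2.1.2 = 1 := by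
  obtain ⟨hκa, hκa'⟩ := mem_perpDirs.1 hκ
  have h1 : (p.1, p.2.1.1) ≠ e₀ := fun h => hx (by rw [← h])
  have h2 : (p.1.shift p.2.1.1, p.2.1.2) ≠ e₀ := fun h => hx (by rw [← h]; exact (shift_apply_of_ne _ hκa).symm)
  have h3 : (p.1.shift p.2.1.2, p.2.1.1) ≠ e₀ := fun h => hx (by rw [← h]; exact (shift_apply_of_ne _ hκa').symm)
  have h4 : (p.1, p.2.1.2) ≠ e₀ := fun h => hx (by rw [← h])
  simp [plaquetteHolonomy, oneLink_apply, h1, h2, h3, h4]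

/-- **The marked plaquette**: the plaquette based at the link's site in a plane `(μ, ν)` whose FIRST edge is the
link `e₀ = (x₀, μ)` has holonomy `g`. -/
theorem hol_oneLink_base [Fact (1 < L)] (x₀ : Site d L) {μ ν : Fin d} (hμν : μ < ν) (g : SU2) :
    plaquetteHolonomy (oneLink (x₀, μ) g) x₀ μ ν = g := by
  have hne : μ ≠ ν := ne_of_lt hμν
  have h2 : (x₀.shift μ, ν) ≠ (x₀, μ) := fun h => hne.symm (congrArg Prod.snd h)
  have h3 : (x₀.shift ν, μ) ≠ (x₀, μ) := fun h => shift_ne_self' x₀ ν (congrArg Prod.fst h)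
  have h4 : (x₀, ν) ≠ (x₀, μ) := fun h => hne.symm (congrArg Prod.snd h)
  simp [plaquetteHolonomy, oneLink_apply, h2, h3, h4]

/-- The one-link configuration does not vanish the weight: `f_c(U_p) > 0` on every plaquette when `f_c(g) > 0`
and some coefficient is positive (`f_c(1) > 0`). -/
theorem fR_oneLink_pos [Fact (1 < L)] (J : ℕ) {c : ℕ → ℝ} (e₀ : Edge d L) {g : SU2} (h1 : 0 < plaqFn J c 1)
    (hg : 0 < plaqFn J c g) (p : Plaquette d L) : 0 < fR J c (plaqRe rhoFund (oneLink e₀ g) p) := by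
  rcases plaqFn_hol_oneLink_cases J c e₀ g p with h | h <;> rw [h]
  · exact h1
  · exact hg

end OneLink

/-! ### The `κ`-slices of the plaquettes `⊥ κ` and their products at the one-link configuration -/

section Slices

variable (b : ℕ) [NeZero b] [NeZero L]

omit [NeZero b] in
/-- The fine torus `(ℤ/bL)^d` has side `> 1` when `b ≥ 2`. -/
theorem fact_one_lt_mul_side (hb : 2 ≤ b) : Fact (1 < b * L) :=
  ⟨by have := NeZero.ne L; nlinarith [Nat.pos_of_ne_zero this]⟩

/-- The `κ`-slices of plaquettes `⊥ κ`: `S_i = {p ⊥ κ : x_κ(p) ≡ i (mod b)}`. -/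
def sliceSet (κ : Fin d) (i : ZMod b) : Finset (Plaquette d (b * L)) :=
  (univ.filter fun p : Plaquette d (b * L) => κ ∈ perpDirs p).filter fun p => resb b L (p.1 κ) = i

/-- `sliceFn` is the product over the slice set (definitional). -/
theorem sliceFn_eq_prod (J : ℕ) (c : ℕ → ℝ) (κ : Fin d) (e : Plaquette d (b * L) → ℕ) (i : ZMod b)
    (W : GaugeConfig d (b * L) SU2) :
    sliceFn b J c κ e i W = ∏ p ∈ sliceSet b κ i, fR J c (plaqRe rhoFund W p) ^ e p := rfl

/-- Membership in a slice set. -/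
theorem mem_sliceSet {κ : Fin d} {i : ZMod b} {p : Plaquette d (b * L)} :
    p ∈ sliceSet b κ i ↔ κ ∈ perpDirs p ∧ resb b L (p.1 κ) = i := by
  simp [sliceSet]

/-- **All slices have the same number of plaquettes** (translation by `e_κ` maps `S_i` onto `S_{i+1}`). -/
theorem card_sliceSet_succ (κ : Fin d) (i : ZMod b) : (sliceSet (L := L) b κ i).card = (sliceSet (L := L) b κ (i + 1)).card := by
  refine Finset.card_bij' (fun p _ => plaqShift (Pi.single κ (1 : ZMod (b * L))) p)
    (fun p _ => plaqShift (Pi.single κ (-1 : ZMod (b * L))) p) (fun p hp => ?_) (fun p hp => ?_) (fun p _ => ?_) (fun p _ => ?_)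
  · obtain ⟨h1, h2⟩ := (mem_sliceSet b).1 hp
    refine (mem_sliceSet b).2 ⟨by rwa [perpDirs_plaqShift], ?_⟩
    simp only [plaqShift, Pi.add_apply, Pi.single_eq_same, resb_add, h2]
    rw [show (1 : ZMod (b * L)) = ((1 : ℕ) : ZMod (b * L)) by push_cast; rfl, resb_natCast]
    push_cast; rfl
  · obtain ⟨h1, h2⟩ := (mem_sliceSet b).1 hp
    refine (mem_sliceSet b).2 ⟨by rwa [perpDirs_plaqShift], ?_⟩
    simp only [plaqShift, Pi.add_apply, Pi.single_eq_same, resb_add, resb_neg, h2]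
    rw [show (1 : ZMod (b * L)) = ((1 : ℕ) : ZMod (b * L)) by push_cast; rfl, resb_natCast]
    push_cast; ring
  · simp [plaqShift, add_assoc, ← Pi.single_add]
  · simp [plaqShift, add_assoc, ← Pi.single_add]

/-- `card S_0 = card S_1`. -/
theorem card_sliceSet_zero_eq_one (κ : Fin d) : (sliceSet (L := L) b κ 0).card = (sliceSet (L := L) b κ 1).card := by
  rw [card_sliceSet_succ b κ 0, zero_add]

/-- **Off the link's slice, the slice product of the one-link configuration at `x₀ = 0` is `f(1)^{#S_i}`.** -/
theorem sliceFn_oneLink_of_ne (J : ℕ) (c : ℕ → ℝ) (κ μ : Fin d) (g : SU2) {i : ZMod b} (hi : i ≠ 0) :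
    sliceFn b J c κ (fun _ => 1) i (oneLink ((0 : Site d (b * L)), μ) g) = plaqFn J c 1 ^ (sliceSet (L := L) b κ i).card := by
  rw [sliceFn_eq_prod, ← Finset.prod_const]
  refine Finset.prod_congr rfl fun p hp => ?_
  obtain ⟨hκ, hres⟩ := (mem_sliceSet b).1 hp
  have hx : p.1 κ ≠ (0 : Site d (b * L)) κ := by
    intro h
    rw [h, Pi.zero_apply, show resb b L (0 : ZMod (b * L)) = 0 from map_zero _] at hres
    exact hi hres.symm
  rw [pow_one, ← plaqFn_hol_eq_fR, hol_oneLink_eq_one_of_ne _ g hκ hx]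

/-- **On the link's slice the slice product differs from `f(1)^{#S_0}`** when `0 < f(g) ≠ f(1)` (`d ≥ 3`: the
marked plaquette `(0; μ, ν)` with `μ, ν ≠ κ` lies in `S_0` and carries `f(g)`; all other factors are `f(1)` or `f(g)`). -/
theorem sliceFn_oneLink_zero_ne (hb : 2 ≤ b) (J : ℕ) {c : ℕ → ℝ} {κ μ ν : Fin d} (hμν : μ < ν) (hκμ : κ ≠ μ) (hκν : κ ≠ ν)
    {g : SU2} (h1 : 0 < plaqFn J c 1) (hg : 0 < plaqFn J c g) (hne : plaqFn J c g ≠ plaqFn J c 1) :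
    sliceFn b J c κ (fun _ => 1) 0 (oneLink ((0 : Site d (b * L)), μ) g) ≠
      plaqFn J c 1 ^ (sliceSet (L := L) b κ 0).card := by
  haveI := fact_one_lt_mul_side (L := L) b hb
  set W := oneLink ((0 : Site d (b * L)), μ) g with hW
  set p₀ : Plaquette d (b * L) := ((0 : Site d (b * L)), ⟨(μ, ν), hμν⟩) with hp₀
  have hp₀mem : p₀ ∈ sliceSet (L := L) b κ 0 :=
    (mem_sliceSet b).2 ⟨mem_perpDirs.2 ⟨hκμ, hκν⟩, by simp [hp₀, resb]⟩
  have hval₀ : fR J c (plaqRe rhoFund W p₀) = plaqFn J c g := by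
    rw [← plaqFn_hol_eq_fR, hW, hp₀]
    exact congrArg (plaqFn J c) (hol_oneLink_base (0 : Site d (b * L)) hμν g)
  rw [sliceFn_eq_prod]
  simp_rw [pow_one]
  rw [← Finset.mul_prod_erase _ _ hp₀mem, hval₀]
  have hcard : ((sliceSet (L := L) b κ 0).erase p₀).card + 1 = (sliceSet (L := L) b κ 0).card :=
    Finset.card_erase_add_one hp₀mem
  rw [← hcard, pow_succ']
  -- every remaining factor is `f(1)` or `f(g)`
  have hfac : ∀ p ∈ (sliceSet (L := L) b κ 0).erase p₀,
      fR J c (plaqRe rhoFund W p) = plaqFn J c 1 ∨ fR J c (plaqRe rhoFund W p) = plaqFn J c g :=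
    fun p _ => plaqFn_hol_oneLink_cases J c _ g p
  have hPpos : 0 < ∏ p ∈ (sliceSet (L := L) b κ 0).erase p₀, fR J c (plaqRe rhoFund W p) :=
    Finset.prod_pos fun p _ => fR_oneLink_pos J _ h1 hg p
  rcases lt_or_gt_of_ne hne with hlt | hgt
  · -- `f(g) < f(1)`: the product is `< f(1)^{n}`
    have hle : ∏ p ∈ (sliceSet (L := L) b κ 0).erase p₀, fR J c (plaqRe rhoFund W p) ≤
        plaqFn J c 1 ^ ((sliceSet (L := L) b κ 0).erase p₀).card := by
      rw [← Finset.prod_const]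
      exact Finset.prod_le_prod (fun p _ => (fR_oneLink_pos J _ h1 hg p).le) fun p hp => by
        rcases hfac p hp with h | h <;> rw [h]; exact hlt.le
    exact (mul_lt_mul hlt hle hPpos h1.le).ne
  · -- `f(g) > f(1)`: the product is `> f(1)^{n}`
    have hle : plaqFn J c 1 ^ ((sliceSet (L := L) b κ 0).erase p₀).card ≤
        ∏ p ∈ (sliceSet (L := L) b κ 0).erase p₀, fR J c (plaqRe rhoFund W p) := by
      rw [← Finset.prod_const]
      exact Finset.prod_le_prod (fun p _ => h1.le) fun p hp => by
        rcases hfac p hp with h | h <;> rw [h]; exact hgt.le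
    exact (mul_lt_mul hgt hle (pow_pos h1 _) hg.le).ne'

end Slices

end Summit.Ventures.YMGap.Census

end
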